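import Mathlib
import Literature.Computability.Complexity.BooleanFourier
import HarnessLib

/-!
# `LiouvilleOrthogonalTC0` (stmt-QuantumAdvantage-1393), line `Sketch` — stub `stub_ltfInfluence`
# (total influence of a linear threshold function is at most `√m`)

For real weights `W : Fin m → ℝ` and a threshold `Θ`, the linear threshold function
`g(σ) = [Θ ≤ Σ_l W_l σ_l]` on the cube `{0,1}^m` satisfies

  `Σ_σ #{j : g(σ) ≠ g(σ with bit j flipped)} ≤ 2^m · √m`,

i.e. its total influence `I[g] = Σ_j Pr_σ[g(σ) ≠ g(σ^{⊕j})]` is at most `√m` (O'Donnell,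
*Analysis of Boolean Functions*, 2014, §2.3: the level-1 inequality for unate functions; this is
the combinatorial input of Peres' noise-stability theorem for threshold functions).

Proof. `g` is UNATE: along coordinate `j` it is monotone in the direction `o_j = [0 ≤ W_j]`
(`StubLtfInfluence.ltf_unate`). For a unate `g` and `G = sgn ∘ g ∈ {±1}` the pointwise identity
`(G(σ) - G(σ^{⊕j})) · χ_j(σ) = 2 · sgn(¬o_j) · [g(σ) ≠ g(σ^{⊕j})]` (`sgn_sub_sgn_mul_sgn`, a
16-case check) summed over `σ`, together with the flip involution `σ ↦ σ^{⊕j}`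
(`Function.update σ j (¬σ_j)`), gives `#{σ : g(σ) ≠ g(σ^{⊕j})} = |Σ_σ G(σ) χ_j(σ)| = 2^m |Ĝ({j})|`
(`card_filter_eq_abs_sum`). Then Cauchy–Schwarz (`sq_sum_le_card_mul_sum_sq`) and Parseval on
the cube (`Literature.Computability.Complexity.LowDegree.sum_cubeFourierCoeff_sq`, the singletons
`{j}` being distinct sets) give
`Σ_j |Ĝ({j})| ≤ √m · (Σ_j Ĝ({j})²)^{1/2} ≤ √m · (Σ_S Ĝ(S)²)^{1/2} = √m`.
-/

set_option linter.dupNamespace false -- D-0017: single-problem summit ⇒ `QuantumAdvantage.QuantumAdvantage` by design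

noncomputable section

namespace Summit.QuantumAdvantage.QuantumAdvantage.Theorems.LiouvilleOrthogonalTC0

open Finset
open Literature.Probability.RandomGraphs.LowDegree (sgn walsh sgn_mul_self)
open Literature.Computability.Complexity.LowDegree (cubeFourierCoeff sum_cubeFourierCoeff_sq)

namespace StubLtfInfluence

variable {m : ℕ}

/-! ### Bit flips and signs -/

/-- Flipping bit `j` twice is the identity. -/
theorem update_not_update_not (j : Fin m) (σ : Fin m → Bool) :
    Function.update (Function.update σ j (!σ j)) j (!Function.update σ j (!σ j) j) = σ := by
  rw [Function.update_idem, Function.update_self, Bool.not_not, Function.update_eq_self]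

/-- Flipping bit `j` is an involution of the cube. -/
theorem flip_involutive (j : Fin m) :
    Function.Involutive (fun σ : Fin m → Bool => Function.update σ j (!σ j)) :=
  update_not_update_not j

/-- The pointwise identity behind "influence = |level-1 coefficient|" for a function monotone in
one fixed direction along a coordinate: with `a = g(σ)`, `b = g(σ^{⊕j})`, `c = σ_j` and `o` the
orientation, `(sgn a - sgn b) · sgn c = 2 · sgn(¬o) · [a ≠ b]` (a finite check). -/
theorem sgn_sub_sgn_mul_sgn (a b c o : Bool)
    (h : if c = o then (b = true → a = true) else (a = true → b = true)) :
    (sgn a - sgn b) * sgn c = 2 * sgn (!o) * (if a = b then 0 else 1) := by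
  revert h
  cases a <;> cases b <;> cases c <;> cases o <;> norm_num [sgn]

/-! ### Influence along one coordinate of a unate function -/

/-- For `g` monotone along coordinate `j` in direction `o`
(`g(σ|_{j←¬o}) = 1 ⇒ g(σ|_{j←o}) = 1`), the level-1 character sum of `sgn ∘ g` at `j` is, up to
the sign `sgn(¬o)`, the number of points where `g` is sensitive to bit `j`. -/
theorem sum_sgn_mul_sgn_eq (g : (Fin m → Bool) → Bool) (j : Fin m) (o : Bool)
    (ho : ∀ σ, g (Function.update σ j (!o)) = true → g (Function.update σ j o) = true) :
    ∑ σ, sgn (g σ) * sgn (σ j) =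
      sgn (!o) * ((univ.filter fun σ => g σ ≠ g (Function.update σ j (!σ j))).card : ℝ) := by
  -- the pointwise identity
  have hpt : ∀ σ : Fin m → Bool, (sgn (g σ) - sgn (g (Function.update σ j (!σ j)))) * sgn (σ j) =
      2 * sgn (!o) * (if g σ = g (Function.update σ j (!σ j)) then 0 else 1) := by
    intro σ
    apply sgn_sub_sgn_mul_sgn
    by_cases hc : σ j = o
    · rw [if_pos hc]
      have h1 : Function.update σ j (!o) = Function.update σ j (!σ j) := by rw [hc]
      have h2 : Function.update σ j o = σ := by rw [← hc, Function.update_eq_self]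
      intro hb
      have := ho σ (by rw [h1]; exact hb)
      rwa [h2] at this
    · rw [if_neg hc]
      have hc' : σ j = !o := by
        cases o <;> cases h : σ j <;> simp_all
      have h1 : Function.update σ j (!o) = σ := by rw [← hc', Function.update_eq_self]
      have h2 : Function.update σ j o = Function.update σ j (!σ j) := by rw [hc', Bool.not_not]
      intro ha
      have := ho σ (by rw [h1]; exact ha)
      rwa [h2] at this
  -- summing the flipped term gives minus the original sum (the flip is an involution)
  have key : ∑ σ : Fin m → Bool, sgn (g (Function.update σ j (!σ j))) *
      sgn (Function.update σ j (!σ j) j) = ∑ σ, sgn (g σ) * sgn (σ j) :=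
    (flip_involutive j).bijective.sum_comp (fun σ => sgn (g σ) * sgn (σ j))
  have hflip : ∑ σ : Fin m → Bool, sgn (g (Function.update σ j (!σ j))) * sgn (σ j) =
      -∑ σ, sgn (g σ) * sgn (σ j) := by
    rw [← key, ← Finset.sum_neg_distrib]
    refine Finset.sum_congr rfl fun σ _ => ?_
    rw [Function.update_self]
    cases σ j <;> simp
  have hsum : ∑ σ : Fin m → Bool, (sgn (g σ) - sgn (g (Function.update σ j (!σ j)))) * sgn (σ j) =
      2 * ∑ σ, sgn (g σ) * sgn (σ j) := by
    simp_rw [sub_mul]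
    rw [Finset.sum_sub_distrib, hflip]
    ring
  have hcard : ((univ.filter fun σ => g σ ≠ g (Function.update σ j (!σ j))).card : ℝ) =
      ∑ σ, (if g σ = g (Function.update σ j (!σ j)) then (0 : ℝ) else 1) := by
    rw [Finset.natCast_card_filter]
    refine Finset.sum_congr rfl fun σ _ => ?_
    by_cases h : g σ = g (Function.update σ j (!σ j)) <;> simp [h]
  have h2 : 2 * ∑ σ, sgn (g σ) * sgn (σ j) =
      2 * (sgn (!o) * ∑ σ, (if g σ = g (Function.update σ j (!σ j)) then (0 : ℝ) else 1)) := by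
    rw [← hsum, Finset.sum_congr rfl (fun σ _ => hpt σ), ← Finset.mul_sum, mul_assoc]
  rw [hcard]
  linarith

/-- Along a unate coordinate, the number of sensitive points is the absolute level-1 character
sum `|Σ_σ sgn(g σ) χ_j(σ)|` (O'Donnell 2014, Prop. 2.21 for unate functions). -/
theorem card_filter_eq_abs_sum (g : (Fin m → Bool) → Bool) (j : Fin m)
    (hg : ∃ o : Bool,
      ∀ σ, g (Function.update σ j (!o)) = true → g (Function.update σ j o) = true) :
    ((univ.filter fun σ => g σ ≠ g (Function.update σ j (!σ j))).card : ℝ) =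
      |∑ σ, sgn (g σ) * sgn (σ j)| := by
  obtain ⟨o, ho⟩ := hg
  rw [sum_sgn_mul_sgn_eq g j o ho, abs_mul, Nat.abs_cast]
  cases o <;> simp

/-! ### The level-1 inequality -/

/-- The level-1 character sum is `2^m` times the Fourier–Walsh coefficient at `{j}`. -/
theorem sum_sgn_mul_sgn_eq_cubeFourierCoeff (g : (Fin m → Bool) → Bool) (j : Fin m) :
    ∑ σ, sgn (g σ) * sgn (σ j) = 2 ^ m * cubeFourierCoeff (fun σ => sgn (g σ)) {j} := by
  rw [cubeFourierCoeff, mul_div_cancel₀ _ (by positivity)]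
  simp [walsh]

/-- Parseval for a `±1`-valued function: `Σ_S Ĝ(S)² = 1`. -/
theorem sum_cubeFourierCoeff_sgn_sq (g : (Fin m → Bool) → Bool) :
    ∑ S, cubeFourierCoeff (fun σ => sgn (g σ)) S ^ 2 = 1 := by
  rw [sum_cubeFourierCoeff_sq]
  simp only [sq, sgn_mul_self, Finset.sum_const, Finset.card_univ, Fintype.card_fun,
    Fintype.card_bool, Fintype.card_fin, nsmul_eq_mul, mul_one]
  rw [Nat.cast_pow, Nat.cast_ofNat]
  exact div_self (by positivity)

/-- The level-1 Fourier weight is at most `1`: `Σ_j Ĝ({j})² ≤ Σ_S Ĝ(S)² = 1`. -/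
theorem sum_cubeFourierCoeff_singleton_sq_le (g : (Fin m → Bool) → Bool) :
    ∑ j : Fin m, cubeFourierCoeff (fun σ => sgn (g σ)) {j} ^ 2 ≤ 1 := by
  rw [← sum_cubeFourierCoeff_sgn_sq g]
  calc ∑ j : Fin m, cubeFourierCoeff (fun σ => sgn (g σ)) {j} ^ 2
      = ∑ S ∈ (univ : Finset (Fin m)).map ⟨fun j : Fin m => ({j} : Finset (Fin m)),
          Finset.singleton_injective⟩, cubeFourierCoeff (fun σ => sgn (g σ)) S ^ 2 := by
        rw [Finset.sum_map]
        rfl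
    _ ≤ ∑ S, cubeFourierCoeff (fun σ => sgn (g σ)) S ^ 2 :=
        Finset.sum_le_sum_of_subset_of_nonneg (Finset.subset_univ _) fun _ _ _ => sq_nonneg _

/-- The level-1 inequality in `ℓ¹` form: `Σ_j |Ĝ({j})| ≤ √m` (Cauchy–Schwarz and Parseval). -/
theorem sum_abs_cubeFourierCoeff_singleton_le (g : (Fin m → Bool) → Bool) :
    ∑ j : Fin m, |cubeFourierCoeff (fun σ => sgn (g σ)) {j}| ≤ Real.sqrt m := by
  have h := sq_sum_le_card_mul_sum_sq (s := (univ : Finset (Fin m)))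
    (f := fun j => |cubeFourierCoeff (fun σ => sgn (g σ)) {j}|)
  simp only [Finset.card_univ, Fintype.card_fin, sq_abs] at h
  have h' : (∑ j : Fin m, |cubeFourierCoeff (fun σ => sgn (g σ)) {j}|) ^ 2 ≤ m :=
    h.trans (mul_le_of_le_one_right (Nat.cast_nonneg m) (sum_cubeFourierCoeff_singleton_sq_le g))
  calc ∑ j : Fin m, |cubeFourierCoeff (fun σ => sgn (g σ)) {j}|
      = |(∑ j : Fin m, |cubeFourierCoeff (fun σ => sgn (g σ)) {j}|)| :=
        (abs_of_nonneg (Finset.sum_nonneg fun _ _ => abs_nonneg _)).symm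
    _ ≤ Real.sqrt m := Real.abs_le_sqrt h'

/-- **Total influence of a unate Boolean function is at most `√m`** (O'Donnell 2014, §2.3), as a
count of (point, sensitive coordinate) pairs: if along every coordinate `j` the function `g` is
monotone in some fixed direction `o_j`, then `Σ_σ #{j : g(σ) ≠ g(σ^{⊕j})} ≤ 2^m √m`. -/
theorem unate_influence_le (g : (Fin m → Bool) → Bool)
    (hg : ∀ j : Fin m, ∃ o : Bool,
      ∀ σ, g (Function.update σ j (!o)) = true → g (Function.update σ j o) = true) :
    (∑ σ : Fin m → Bool,
        ((univ.filter fun j : Fin m => g σ ≠ g (Function.update σ j (!σ j))).card : ℝ)) ≤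
      2 ^ m * Real.sqrt m := by
  calc (∑ σ : Fin m → Bool,
          ((univ.filter fun j : Fin m => g σ ≠ g (Function.update σ j (!σ j))).card : ℝ))
      = ∑ σ : Fin m → Bool, ∑ j : Fin m,
          (if g σ ≠ g (Function.update σ j (!σ j)) then (1 : ℝ) else 0) := by
        simp_rw [Finset.natCast_card_filter]
    _ = ∑ j : Fin m, ∑ σ : Fin m → Bool,
          (if g σ ≠ g (Function.update σ j (!σ j)) then (1 : ℝ) else 0) :=
        Finset.sum_comm
    _ = ∑ j : Fin m,
          ((univ.filter fun σ : Fin m → Bool => g σ ≠ g (Function.update σ j (!σ j))).card : ℝ) := by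
        simp_rw [Finset.natCast_card_filter]
    _ = ∑ j : Fin m, 2 ^ m * |cubeFourierCoeff (fun σ => sgn (g σ)) {j}| := by
        refine Finset.sum_congr rfl fun j _ => ?_
        rw [card_filter_eq_abs_sum g j (hg j), sum_sgn_mul_sgn_eq_cubeFourierCoeff, abs_mul,
          abs_of_pos (by positivity : (0 : ℝ) < 2 ^ m)]
    _ = 2 ^ m * ∑ j : Fin m, |cubeFourierCoeff (fun σ => sgn (g σ)) {j}| :=
        (Finset.mul_sum _ _ _).symm
    _ ≤ 2 ^ m * Real.sqrt m :=
        mul_le_mul_of_nonneg_left (sum_abs_cubeFourierCoeff_singleton_le g) (by positivity)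

/-- **A linear threshold function is unate**: along coordinate `j` it is monotone in the
direction `o_j = [0 ≤ W_j]` (raising bit `j` from `¬o_j` to `o_j` adds `|W_j| ≥ 0` to the linear
form). -/
theorem ltf_unate (W : Fin m → ℝ) (Θ : ℝ) (j : Fin m) :
    ∃ o : Bool, ∀ σ : Fin m → Bool,
      decide (Θ ≤ ∑ l, W l * (if Function.update σ j (!o) l then (1 : ℝ) else 0)) = true →
        decide (Θ ≤ ∑ l, W l * (if Function.update σ j o l then (1 : ℝ) else 0)) = true := by
  refine ⟨decide (0 ≤ W j), fun σ h => ?_⟩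
  rw [decide_eq_true_eq] at h ⊢
  refine h.trans (Finset.sum_le_sum fun l _ => ?_)
  by_cases hl : l = j
  · subst hl
    simp only [Function.update_self]
    by_cases hW : 0 ≤ W l
    · simp [hW]
    · simp [hW, (not_le.mp hW).le]
  · simp [Function.update_of_ne hl]

end StubLtfInfluence

open StubLtfInfluence in
/-- **Stub `stub_ltfInfluence` (line `Sketch`) — total influence of a linear threshold function.**
For the threshold function `g(σ) = [Θ ≤ Σ_l W_l σ_l]` on `{0,1}^m`, the number of pairs
(point, sensitive coordinate) is at most `2^m √m`, i.e. `I[g] = Σ_j |ĝ({j})| ≤ √m`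
(O'Donnell, *Analysis of Boolean Functions*, 2014, §2.3), by unateness (`ltf_unate`),
the flip involution, Cauchy–Schwarz and Parseval (`unate_influence_le`). -/
theorem stub_ltfInfluence (m : ℕ) (W : Fin m → ℝ) (Θ : ℝ) :
    (∑ σ : Fin m → Bool,
        ((univ.filter fun j : Fin m =>
            decide (Θ ≤ ∑ l, W l * (if σ l then (1 : ℝ) else 0)) ≠
              decide (Θ ≤ ∑ l, W l * (if Function.update σ j (!σ j) l then (1 : ℝ) else 0))).card
          : ℝ))
      ≤ 2 ^ m * Real.sqrt m :=
  unate_influence_le (fun σ => decide (Θ ≤ ∑ l, W l * (if σ l then (1 : ℝ) else 0)))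
    (ltf_unate W Θ)

end Summit.QuantumAdvantage.QuantumAdvantage.Theorems.LiouvilleOrthogonalTC0

end
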